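import Mathlib
import Summits.ValiantsHypothesis.ValiantsHypothesis.Theses.NumTame
import Summits.ValiantsHypothesis.ValiantsHypothesis.Theorems.NumTameGrowthLemma
import HarnessLib

/-!
# Route NumTame — the REPAIRED glue `MagnitudeGlue` (support for stmt-ValiantsHypothesis-5388)

Item stmt-5388 `MagnitudeGlue : MagnitudeNF → TameNF` is mis-stated as filed (refuter g42-8, route
review 2026-08-15, evidence `NumTameTowerLoophole.lean`): the tree's circuit model allows the empty
product gate `prod []` (value `1`, formal degree `0`), and towers above it reach doubly-exponential
cube values at formal degree `0`, so `MagnitudeNF`'s formal-degree budget does not bound cube values.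
The corrected growth lemma (formal degrees `≥ 1` ⇒ `‖g_j(x)‖ ≤ 2^((R+1)(j+2)·fdeg_j)`) is PROVED in
`NumTameGrowthLemma.lean` (val-lit-p8 g2, `NumTameGrowth.tame_values_of_bounds`).

This file lands the glue under the REPAIRED hypothesis, i.e. the exact restatement under which the
item closes at once: `tameNF_of_magnitudeNF_posDeg` — **`MagnitudeNF` with the extra conclusion
"every formal degree of the new circuit is `≥ 1`" implies `TameNF`** (`…Theses.NumTame.TameNF` by
name). The only new work is exponent bookkeeping: with `E = N^c + c` the growth lemma bounds cube
values by `2^((E+1)(E+2)E)`, and `(E+1)(E+2)E ≤ N^{c'} + c'` uniformly in `N` for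
`c' = 8 (c+3)³ + 3c + 3` (`growth_exponent_le`).

Honest framing: bookkeeping for an open, conditional route (NumTame); `VP ≠ VNP` is NOT proved and
nothing here is progress on it.

## References

* P. Bürgisser, *On defining integers and proving arithmetic circuit lower bounds*, Comput.
  Complexity 18 (2009), §2.2 (formal degree). [cite: Burgisser2006, §2.2]
* P. Bürgisser, *Completeness and Reduction in Algebraic Complexity Theory* (2000), Def. 2.1.
  [cite: Burgisser2000, Def. 2.1]
-/

set_option linter.dupNamespace false

noncomputable section

open MvPolynomial

namespace Summit.ValiantsHypothesis.ValiantsHypothesis.Theorems.NumTame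

open Literature.Computability.AlgebraicComplexity ArithCircuit

/-! ### Exponent bookkeeping -/

/-- **The exponent bookkeeping of the repaired glue**: with `E = N^c + c` and
`c' = 8 (c+3)³ + 3c + 3`, `(E+1)(E+2)E ≤ N^{c'} + c'` for every `N`. [folklore] -/
theorem growth_exponent_le (N c : ℕ) :
    (N ^ c + c + 1) * (N ^ c + c + 2) * (N ^ c + c) ≤
      N ^ (8 * (c + 3) ^ 3 + 3 * c + 3) + (8 * (c + 3) ^ 3 + 3 * c + 3) := by
  set X := N ^ c with hX
  set c' := 8 * (c + 3) ^ 3 + 3 * c + 3 with hc'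
  -- `(E+1)(E+2)E ≤ (E+2)^3 ≤ ((c+3)(X+1))^3`
  have h1 : (X + c + 1) * (X + c + 2) * (X + c) ≤ (X + c + 2) ^ 3 := by
    have ha : X + c + 1 ≤ X + c + 2 := by omega
    have hb : X + c ≤ X + c + 2 := by omega
    calc (X + c + 1) * (X + c + 2) * (X + c) ≤ (X + c + 2) * (X + c + 2) * (X + c + 2) :=
          Nat.mul_le_mul (Nat.mul_le_mul ha le_rfl) hb
      _ = (X + c + 2) ^ 3 := by ring
  have h2 : X + c + 2 ≤ (c + 3) * (X + 1) := by nlinarith [Nat.zero_le (c * X), Nat.zero_le X]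
  have h3 : (X + c + 2) ^ 3 ≤ (c + 3) ^ 3 * (X + 1) ^ 3 := by
    rw [← mul_pow]
    exact Nat.pow_le_pow_left h2 3
  refine (h1.trans h3).trans ?_
  rcases Nat.lt_or_ge N 2 with hN | hN
  · -- `N ≤ 1`: `X ≤ 1`, everything is bounded by the constant `c'`
    have hX1 : X ≤ 1 := by
      rw [hX]
      rcases Nat.lt_or_ge N 1 with h0 | h1'
      · have : N = 0 := by omega
        subst this
        rcases Nat.eq_zero_or_pos c with rfl | hc
        · simp
        · rw [zero_pow hc.ne']; exact Nat.zero_le _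
      · have : N = 1 := by omega
        subst this
        simp
    have h8 : (X + 1) ^ 3 ≤ 8 := by
      calc (X + 1) ^ 3 ≤ (1 + 1) ^ 3 := Nat.pow_le_pow_left (by omega) 3
        _ = 8 := by norm_num
    calc (c + 3) ^ 3 * (X + 1) ^ 3 ≤ (c + 3) ^ 3 * 8 := Nat.mul_le_mul_left _ h8
      _ ≤ c' := by rw [hc']; omega
      _ ≤ N ^ c' + c' := Nat.le_add_left _ _
  · -- `N ≥ 2`: everything is bounded by the power `N^{c'}`
    have hX1 : 1 ≤ X := by rw [hX]; exact Nat.one_le_pow _ _ (by omega)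
    have h8 : (X + 1) ^ 3 ≤ N ^ 3 * N ^ (3 * c) := by
      calc (X + 1) ^ 3 ≤ (2 * X) ^ 3 := Nat.pow_le_pow_left (by omega) 3
        _ = 2 ^ 3 * X ^ 3 := by ring
        _ ≤ N ^ 3 * X ^ 3 := Nat.mul_le_mul_right _ (Nat.pow_le_pow_left hN 3)
        _ = N ^ 3 * N ^ (3 * c) := by rw [hX, ← pow_mul, mul_comm c 3]
    have hc3 : (c + 3) ^ 3 ≤ N ^ ((c + 3) ^ 3) :=
      (Nat.lt_two_pow_self).le.trans (Nat.pow_le_pow_left hN _)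
    calc (c + 3) ^ 3 * (X + 1) ^ 3 ≤ N ^ ((c + 3) ^ 3) * (N ^ 3 * N ^ (3 * c)) :=
          Nat.mul_le_mul hc3 h8
      _ = N ^ ((c + 3) ^ 3 + 3 + 3 * c) := by rw [← pow_add, ← pow_add, Nat.add_assoc]
      _ ≤ N ^ c' := Nat.pow_le_pow_right (by omega) (by rw [hc']; omega)
      _ ≤ N ^ c' + c' := Nat.le_add_right _ _

/-- `E = N^c + c ≤ N^{c'} + c'` for the same `c'`. [folklore] -/
theorem budget_le (N c : ℕ) :
    N ^ c + c ≤ N ^ (8 * (c + 3) ^ 3 + 3 * c + 3) + (8 * (c + 3) ^ 3 + 3 * c + 3) := by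
  refine (Nat.le_mul_of_pos_left (N ^ c + c) (by positivity : 0 < (N ^ c + c + 1) * (N ^ c + c + 2))).trans
    (growth_exponent_le N c)

/-! ### The repaired glue -/

/-- **The REPAIRED `MagnitudeGlue` (support for stmt-ValiantsHypothesis-5388).** If every fan-in-two
circuit can be replaced, at polynomial cost `N^c + c` (`N = |P| + n + t + deg f`), by one computing
the same `f` with all formal degrees in `[1, N^c + c]` and all constants, sum weights and output
constant of modulus `≤ 2^(N^c + c)` — i.e. `MagnitudeNF` WITH the clause "formal degrees `≥ 1`"
that closes the empty-product loophole — then `TameNF` holds: by the corrected growth lemma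
(`NumTameGrowth.tame_values_of_bounds`) every cube value has modulus `≤ 2^((E+1)(E+2)E)`,
`E = N^c + c`, and `(E+1)(E+2)E ≤ N^{c'} + c'` with `c' = 8(c+3)³ + 3c + 3` (`growth_exponent_le`).
As filed (without the clause) the implication is not derivable from the growth lemma (refuter
evidence `NumTameTowerLoophole.lean` on the item). [cite: Burgisser2006, §2.2] -/
theorem tameNF_of_magnitudeNF_posDeg
    (h : ∃ c : ℕ, ∀ (n t : ℕ) (f : MvPolynomial (Fin n) ℂ), (∀ m, ‖MvPolynomial.coeff m f‖ ≤ (2 : ℝ) ^ t) →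
      ∀ P : ArithCircuit ℂ (Fin n), P.IsFanInTwo → P.Computes f →
        ∃ P' : ArithCircuit ℂ (Fin n), P'.Computes f ∧
          P'.size ≤ (P.size + n + t + f.totalDegree) ^ c + c ∧ P'.IsFanInTwo ∧
          (∀ d ∈ gateFormalDegrees P'.gates, d ≤ (P.size + n + t + f.totalDegree) ^ c + c) ∧
          (∀ d ∈ gateFormalDegrees P'.gates, 1 ≤ d) ∧
          (∀ g ∈ P'.gates, ∀ u ∈ Gate.args g, ∀ a : ℂ, u = Operand.const a →
            ‖a‖ ≤ (2 : ℝ) ^ ((P.size + n + t + f.totalDegree) ^ c + c)) ∧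
          (∀ args, Gate.sum args ∈ P'.gates → ∀ a ∈ args,
            ‖a.1‖ ≤ (2 : ℝ) ^ ((P.size + n + t + f.totalDegree) ^ c + c)) ∧
          ∀ a : ℂ, P'.output = Operand.const a →
            ‖a‖ ≤ (2 : ℝ) ^ ((P.size + n + t + f.totalDegree) ^ c + c)) :
    Summit.ValiantsHypothesis.ValiantsHypothesis.Theses.NumTame.TameNF := by
  obtain ⟨c, hc⟩ := h
  refine ⟨8 * (c + 3) ^ 3 + 3 * c + 3, fun n t f hf P h2 hP => ?_⟩
  obtain ⟨P', hcomp, hsize, hfan, hdeg, hpos, hconst, hw, hout⟩ := hc n t f hf P h2 hP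
  set N := P.size + n + t + f.totalDegree with hN
  set E := N ^ c + c with hE
  set E' := N ^ (8 * (c + 3) ^ 3 + 3 * c + 3) + (8 * (c + 3) ^ 3 + 3 * c + 3) with hE'
  have hEE' : E ≤ E' := budget_le N c
  have hpowEE' : (2 : ℝ) ^ E ≤ (2 : ℝ) ^ E' := pow_le_pow_right₀ (by norm_num) hEE'
  have hval := NumTameGrowth.tame_values_of_bounds P' E hfan hsize hconst hw hpos hdeg
  have hgrow : (2 : ℝ) ^ ((E + 1) * (E + 2) * E) ≤ (2 : ℝ) ^ E' :=
    pow_le_pow_right₀ (by norm_num) (growth_exponent_le N c)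
  refine ⟨P', hcomp, hsize.trans hEE', hfan, ?_, ?_, ?_, ?_⟩
  · exact fun g hg u hu a ha => (hconst g hg u hu a ha).trans hpowEE'
  · exact fun args hargs a ha => (hw args hargs a ha).trans hpowEE'
  · exact fun a ha => (hout a ha).trans hpowEE'
  · exact fun g hg x => (hval g hg x).trans hgrow

end Summit.ValiantsHypothesis.ValiantsHypothesis.Theorems.NumTame

end
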